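import Mathlib
import Summits.Ventures.PercRepro2.Defs
import Summits.Ventures.PercRepro2.Independence
import Summits.Ventures.PercRepro2.Harris
import Summits.Ventures.PercRepro2.Graph
import Summits.Ventures.PercRepro2.Exploration
import Summits.Ventures.PercRepro2.Events
import Summits.Ventures.PercRepro2.FourFunctions
import Summits.Ventures.PercRepro2.Induced
import Summits.Ventures.PercRepro2.Frontier
import Summits.Ventures.PercRepro2.ObsIndependence
import Summits.Ventures.PercRepro2.BHK
import Summits.Ventures.PercRepro2.VdBKahn

/-!
# The van den Berg–Häggström–Kahn inequality for functionals of the OPEN-EDGE cluster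
(blind cell PercRepro2, typer-1)

BHK06 (doi:10.1002/rsa.20102, Thm 1.1/1.3) define the open cluster of `s` as the set of EDGES on
open paths from `s` and prove the conditional correlation inequality for functionals increasing
in that edge set; the tree's `bhk_induced` (p1) is the VERTEX-SET form, and events such as
`{a₁ ↔ a₂}` are increasing in the edge cluster of a merged vertex but are not functions of its
vertex set (lead ADDENDUM 10 (10b)), so the edge form is needed for (N0).
`edgeClusterIn ends U s ω` = the open edges of `G[U]` with an endpoint (hence both) in `C^U_s`;
`edgeObs ends U s F = F ∘ edgeClusterIn`.  For nonnegative monotone `F₁, F₂` and `X, Y ⊆ U`: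
  `E(F₁(EC^U_s) 1_{R_X}) · E(F₂(EC^U_s) 1_{R_Y}) ≤ E((F₁F₂)(EC^U_s) 1_{R_{X∩Y}}) · P(R_{X∪Y})`
(`bhk_edge_induced`; whole graph `bhk_edge`) — p1's exploration induction verbatim; the one new
ingredient is `edgeClusterIn_sdiff_eq` (on `{s ↮ Z}` the edge cluster avoids `Z`).
-/

namespace Summit.Ventures.PercRepro2

/-! ## The open-edge cluster -/

section EdgeCluster

variable {V : Type*} {E : Type*} {R : Type*} {ends : E → Sym2 V} {U : Finset V} {s : V}

/-- The open-edge cluster of `s` in `G[U]`: the open edges of `G[U]` with an endpoint in `C^U_s`. -/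
def edgeClusterIn (ends : E → Sym2 V) (U : Finset V) (s : V) (ω : Config E) : Set E :=
  {e | induced ends (↑U) ω e = true ∧ ∃ x y, ends e = s(x, y) ∧ x ∈ clusterIn ends U s ω}

/-- Membership in the edge cluster. -/
@[simp] lemma mem_edgeClusterIn {ω : Config E} {e : E} :
    e ∈ edgeClusterIn ends U s ω ↔
      induced ends (↑U) ω e = true ∧ ∃ x y, ends e = s(x, y) ∧ x ∈ clusterIn ends U s ω :=
  Iff.rfl

/-- A functional of the open-edge cluster of `s` in `G[U]`. -/
def edgeObs (ends : E → Sym2 V) (U : Finset V) (s : V) (F : Set E → R) : Config E → R :=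
  fun ω => F (edgeClusterIn ends U s ω)

/-- Unfolding `edgeObs`. -/
@[simp] lemma edgeObs_apply (F : Set E → R) (ω : Config E) :
    edgeObs ends U s F ω = F (edgeClusterIn ends U s ω) := rfl

/-- Both endpoints of an edge of the edge cluster lie in the vertex cluster. -/
lemma mem_clusterIn_of_mem_edgeClusterIn {ω : Config E} {e : E} (he : e ∈ edgeClusterIn ends U s ω)
    {x y : V} (hxy : ends e = s(x, y)) : x ∈ clusterIn ends U s ω ∧ y ∈ clusterIn ends U s ω := by
  obtain ⟨hopen, x', y', hxy', hx'⟩ := he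
  have hadj : OpenAdj ends (induced ends (↑U) ω) x' y' := ⟨e, hopen, hxy'⟩
  have hy' : y' ∈ clusterIn ends U s ω := conn_trans hx' (conn_of_openAdj hadj)
  rw [hxy, Sym2.eq_iff] at hxy'
  rcases hxy' with ⟨rfl, rfl⟩ | ⟨rfl, rfl⟩
  · exact ⟨hx', hy'⟩
  · exact ⟨hy', hx'⟩

/-- The edge cluster is monotone in the configuration. -/
lemma edgeClusterIn_mono {ω ω' : Config E} (h : ω ≤ ω') :
    edgeClusterIn ends U s ω ⊆ edgeClusterIn ends U s ω' := by
  rintro e ⟨hopen, x, y, hxy, hx⟩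
  refine ⟨?_, x, y, hxy, clusterIn_mono h hx⟩
  have := induced_mono (ends := ends) (U := ↑U) h e
  rw [hopen] at this
  exact Bool.le_iff_imp.1 this rfl

/-- A monotone functional gives a monotone observable. -/
lemma monotone_edgeObs [Preorder R] {F : Set E → R} (hF : Monotone F) :
    Monotone (edgeObs ends U s F) :=
  fun _ _ h => hF (edgeClusterIn_mono h)

/-- `edgeObs` is determined by the edges inside `U`. -/
lemma dependsOn_edgeObs (F : Set E → R) : DependsOn (edgeObs ends U s F) (within ends (↑U)) := by
  intro ω ω' h
  simp only [edgeObs_apply, edgeClusterIn, clusterIn, induced_congr h]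

/-- `edgeObs` of a product is the product. -/
lemma edgeObs_mul [Mul R] (F₁ F₂ : Set E → R) :
    edgeObs ends U s (F₁ * F₂) = edgeObs ends U s F₁ * edgeObs ends U s F₂ := rfl

/-- `edgeObs` of the constant `1` is `1`. -/
lemma edgeObs_one [One R] : edgeObs ends U s (fun _ => (1 : R)) = 1 := rfl

/-- On `{s ↮ Z in G[U]}` the edge cluster of `s` in `G[U ∖ Z]` is its edge cluster in `G[U]`. -/
lemma edgeClusterIn_sdiff_eq [DecidableEq V] {Z : Finset V} {ω : Config E}
    (hR : ∀ z ∈ Z, ¬ Conn ends (induced ends (↑U) ω) s z) :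
    edgeClusterIn ends (U \ Z) s ω = edgeClusterIn ends U s ω := by
  have hC := clusterIn_sdiff_eq (ends := ends) (U := U) (s := s) hR
  ext e
  simp only [mem_edgeClusterIn, hC]
  constructor
  · rintro ⟨hopen, x, y, hxy, hx⟩
    refine ⟨?_, x, y, hxy, hx⟩
    have := induced_mono_set (ends := ends) (Finset.coe_subset.2 (Finset.sdiff_subset (s := U)
      (t := Z))) ω e
    rw [hopen] at this
    exact Bool.le_iff_imp.1 this rfl
  · rintro ⟨hopen, x, y, hxy, hx⟩
    refine ⟨?_, x, y, hxy, hx⟩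
    -- both endpoints lie in `C^U_s`, which avoids `Z`
    have hy : y ∈ clusterIn ends U s ω := by
      have hadj : OpenAdj ends (induced ends (↑U) ω) x y := ⟨e, hopen, hxy⟩
      exact conn_trans hx (conn_of_openAdj hadj)
    rw [induced_eq_true_iff] at hopen ⊢
    obtain ⟨hω, x', hx', y', hy', hxy'⟩ := hopen
    refine ⟨hω, ?_⟩
    have hxZ : x ∉ Z := fun hxZ => hR x hxZ hx
    have hyZ : y ∉ Z := fun hyZ => hR y hyZ hy
    rw [hxy, Sym2.eq_iff] at hxy'
    rcases hxy' with ⟨rfl, rfl⟩ | ⟨rfl, rfl⟩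
    · exact ⟨x, by simp [hx', hxZ], y, by simp [hy', hyZ], hxy⟩
    · exact ⟨y, by simp [hx', hyZ], x, by simp [hy', hxZ], by rw [hxy, Sym2.eq_swap]⟩

end EdgeCluster

/-! ## The inequality on induced subgraphs -/

section EdgeBHKMain

variable {V : Type*} {E : Type*} [Fintype E] [DecidableEq E] [Fintype V] [DecidableEq V]
  {R : Type*} [CommRing R] [LinearOrder R] [IsStrictOrderedRing R]

omit [Fintype E] [DecidableEq E] [Fintype V] [DecidableEq V] in
/-- Nonnegativity of `F(EC_s) · 1_A` for a nonnegative functional. -/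
lemma edgeObs_mul_indicator_nonneg (ends : E → Sym2 V) (U : Finset V) (s : V) {F : Set E → R}
    (hF : ∀ S, 0 ≤ F S) (A : Set (Config E)) (ω : Config E) :
    0 ≤ (edgeObs ends U s F * A.indicator (1 : Config E → R)) ω :=
  mul_nonneg (hF _) (Set.indicator_apply_nonneg fun _ => zero_le_one)

omit [Fintype V] [DecidableEq V] in
/-- Monotonicity in the event: `E(F(EC_s) 1_A) ≤ E(F(EC_s) 1_B)` for `A ⊆ B` and `F ≥ 0`. -/
lemma expect_edgeObs_mul_indicator_mono {p : E → R} (hp : IsProbVec p) (ends : E → Sym2 V)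
    (U : Finset V) (s : V) {F : Set E → R} (hF : ∀ S, 0 ≤ F S) {A B : Set (Config E)}
    (hAB : A ⊆ B) :
    expect p (edgeObs ends U s F * A.indicator 1) ≤ expect p (edgeObs ends U s F * B.indicator 1) := by
  refine expect_mono hp fun ω => ?_
  simp only [Pi.mul_apply]
  refine mul_le_mul_of_nonneg_left ?_ (hF _)
  by_cases h : ω ∈ A
  · rw [Set.indicator_of_mem h, Set.indicator_of_mem (hAB h)]
  · rw [Set.indicator_of_notMem h]
    exact Set.indicator_apply_nonneg fun _ => zero_le_one

omit [Fintype V] in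
/-- The case `X ∩ Y = ∅`: Harris' inequality three times. -/
lemma bhk_edge_induced_of_inter_eq_empty (p : E → R) (hp : IsProbVec p) (ends : E → Sym2 V)
    (s : V) (U : Finset V) {F₁ F₂ : Set E → R} (hF₁ : Monotone F₁) (hF₂ : Monotone F₂)
    (hF₁0 : ∀ S, 0 ≤ F₁ S) (hF₂0 : ∀ S, 0 ≤ F₂ S) (X Y : Finset V) (hZ : X ∩ Y = ∅) :
    expect p (edgeObs ends U s F₁ * (REvent ends U s X).indicator 1) *
        expect p (edgeObs ends U s F₂ * (REvent ends U s Y).indicator 1) ≤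
      expect p (edgeObs ends U s (F₁ * F₂) * (REvent ends U s (X ∩ Y)).indicator 1) *
        prob p (REvent ends U s (X ∪ Y)) := by
  rw [hZ, REvent_empty, Set.indicator_univ, mul_one, REvent_union, edgeObs_mul]
  have hRX := isLowerSet_REvent ends U s X
  have hRY := isLowerSet_REvent ends U s Y
  have h1 := expect_mul_indicator_le_of_isLowerSet hp
    (monotone_edgeObs (ends := ends) (U := U) (s := s) hF₁) hRX
  have h2 := expect_mul_indicator_le_of_isLowerSet hp
    (monotone_edgeObs (ends := ends) (U := U) (s := s) hF₂) hRY
  have h3 := expect_mul_expect_le_expect_mul hp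
    (monotone_edgeObs (ends := ends) (U := U) (s := s) hF₁)
    (monotone_edgeObs (ends := ends) (U := U) (s := s) hF₂)
  have h4 := prob_mul_prob_le_prob_inter_of_isLowerSet hp hRX hRY
  have n1 : 0 ≤ expect p (edgeObs ends U s F₂ * (REvent ends U s Y).indicator 1) :=
    expect_nonneg hp (edgeObs_mul_indicator_nonneg ends U s hF₂0 _)
  have n2 : 0 ≤ expect p (edgeObs ends U s F₁) := expect_nonneg hp fun ω => hF₁0 _
  have n3 : 0 ≤ expect p (edgeObs ends U s F₁ * edgeObs ends U s F₂) :=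
    expect_nonneg hp fun ω => mul_nonneg (hF₁0 _) (hF₂0 _)
  calc expect p (edgeObs ends U s F₁ * (REvent ends U s X).indicator 1) *
        expect p (edgeObs ends U s F₂ * (REvent ends U s Y).indicator 1)
      ≤ (expect p (edgeObs ends U s F₁) * prob p (REvent ends U s X)) *
          (expect p (edgeObs ends U s F₂) * prob p (REvent ends U s Y)) :=
        mul_le_mul h1 h2 n1 (mul_nonneg n2 (prob_nonneg hp _))
    _ = (expect p (edgeObs ends U s F₁) * expect p (edgeObs ends U s F₂)) *
          (prob p (REvent ends U s X) * prob p (REvent ends U s Y)) := by ring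
    _ ≤ expect p (edgeObs ends U s F₁ * edgeObs ends U s F₂) *
          prob p (REvent ends U s X ∩ REvent ends U s Y) :=
        mul_le_mul h3 h4 (mul_nonneg (prob_nonneg hp _) (prob_nonneg hp _)) n3

omit [DecidableEq E] [Fintype V] [LinearOrder R] [IsStrictOrderedRing R] in
/-- **Pointwise transfer to `G[U ∖ Z]`**: for `s ∉ Z ⊆ U`,
`F(EC^U_s) · 1_{R^U_{W ∪ Z}} = F(EC^{U∖Z}_s) · 1_{R^{U∖Z}_{W ∪ frontier}}` configuration by
configuration. -/
lemma edgeObs_mul_indicator_eq (ends : E → Sym2 V) {U Z : Finset V} (hZU : Z ⊆ U) {s : V}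
    (hsZ : s ∉ Z) (F : Set E → R) (W : Finset V) (ω : Config E) :
    (edgeObs ends U s F * (REvent ends U s (W ∪ Z)).indicator (1 : Config E → R)) ω =
      (edgeObs ends (U \ Z) s F *
        (REvent ends (U \ Z) s (W ∪ frontier ends U Z ω)).indicator (1 : Config E → R)) ω := by
  have key := Set.ext_iff.1 (QEvent_inter_REvent_union_eq (ends := ends) hZU hsZ ∅ W) ω
  simp only [QEvent_empty, Set.univ_inter, Set.mem_setOf_eq] at key
  simp only [Pi.mul_apply]
  by_cases h : ω ∈ REvent ends U s (W ∪ Z)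
  · have hR : ∀ z ∈ Z, ¬ Conn ends (induced ends (↑U) ω) s z :=
      fun z hz => h z (Finset.mem_union_right W hz)
    rw [Set.indicator_of_mem h, Set.indicator_of_mem (key.1 h), edgeObs_apply, edgeObs_apply,
      edgeClusterIn_sdiff_eq hR]
  · rw [Set.indicator_of_notMem h, Set.indicator_of_notMem fun h' => h (key.2 h'), mul_zero,
      mul_zero]

omit [LinearOrder R] [IsStrictOrderedRing R] in
/-- **Domain Markov identity for edge-cluster functionals**: for `s ∉ Z ⊆ U`,
`E(F(EC^U_s) 1_{R_{W∪Z}}) = ∑_ω weight p ω · E(F(EC^{U∖Z}_s) 1_{R_{W ∪ frontier ω}})`. -/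
theorem expect_edgeObs_mul_indicator_eq_sum (p : E → R) (ends : E → Sym2 V) {U Z : Finset V}
    (hZU : Z ⊆ U) {s : V} (hsZ : s ∉ Z) (F : Set E → R) (W : Finset V) :
    expect p (edgeObs ends U s F * (REvent ends U s (W ∪ Z)).indicator 1) =
      ∑ ω, weight p ω * expect p (edgeObs ends (U \ Z) s F *
        (REvent ends (U \ Z) s (W ∪ frontier ends U Z ω)).indicator 1) := by
  have e : (edgeObs ends U s F * (REvent ends U s (W ∪ Z)).indicator (1 : Config E → R)) =
      fun ω => (edgeObs ends (U \ Z) s F *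
        (REvent ends (U \ Z) s (W ∪ frontier ends U Z ω)).indicator (1 : Config E → R)) ω :=
    funext fun ω => edgeObs_mul_indicator_eq ends hZU hsZ F W ω
  rw [e]
  exact expect_tower p (F₁ := fun _ => touches ends (↑Z)) (F₂ := fun _ => within ends (↑(U \ Z)))
    (S := frontier ends U Z)
    (Φ := fun T => edgeObs ends (U \ Z) s F * (REvent ends (U \ Z) s (W ∪ T)).indicator 1)
    (fun _ => disjoint_touches_within_sdiff ends U Z)
    (fun T ω ω' h => by
      show (frontier ends U Z ω = T) = (frontier ends U Z ω' = T)
      rw [dependsOn_frontier ends U Z h])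
    fun T => dependsOn_mul (dependsOn_edgeObs F)
      (dependsOn_indicator (dependsOn_REvent ends (U \ Z) s (W ∪ T)))

/-- **van den Berg–Häggström–Kahn on induced subgraphs, edge-cluster form**: for nonnegative
monotone functionals `F₁, F₂` of the open-edge cluster, every vertex set `U` and `X, Y ⊆ U`,
`E(F₁(EC^U_s) 1_{R_X}) · E(F₂(EC^U_s) 1_{R_Y}) ≤ E((F₁F₂)(EC^U_s) 1_{R_{X∩Y}}) · P(R_{X∪Y})`. -/
theorem bhk_edge_induced (p : E → R) (hp : IsProbVec p) (ends : E → Sym2 V) (s : V)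
    {F₁ F₂ : Set E → R} (hF₁ : Monotone F₁) (hF₂ : Monotone F₂) (hF₁0 : ∀ S, 0 ≤ F₁ S)
    (hF₂0 : ∀ S, 0 ≤ F₂ S) (U : Finset V) :
    ∀ X Y : Finset V, X ⊆ U → Y ⊆ U →
      expect p (edgeObs ends U s F₁ * (REvent ends U s X).indicator 1) *
          expect p (edgeObs ends U s F₂ * (REvent ends U s Y).indicator 1) ≤
        expect p (edgeObs ends U s (F₁ * F₂) * (REvent ends U s (X ∩ Y)).indicator 1) *
          prob p (REvent ends U s (X ∪ Y)) := by
  have hF0 : ∀ S, 0 ≤ (F₁ * F₂) S := fun S => mul_nonneg (hF₁0 S) (hF₂0 S)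
  induction U using Finset.strongInduction with
  | H U ih =>
  intro X Y hX hY
  by_cases hZ : X ∩ Y = ∅
  · exact bhk_edge_induced_of_inter_eq_empty p hp ends s U hF₁ hF₂ hF₁0 hF₂0 X Y hZ
  set Z := X ∩ Y with hZdef
  have hZX : Z ⊆ X := Finset.inter_subset_left
  have hZY : Z ⊆ Y := Finset.inter_subset_right
  have hZU : Z ⊆ U := hZX.trans hX
  by_cases hsZ : s ∈ Z
  · have h0 : expect p (edgeObs ends U s F₁ * (REvent ends U s X).indicator 1) = 0 := by
      rw [REvent_eq_empty_of_mem ends U (hZX hsZ)]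
      simp [expect]
    rw [h0, zero_mul]
    exact mul_nonneg (expect_nonneg hp (edgeObs_mul_indicator_nonneg ends U s hF0 _))
      (prob_nonneg hp _)
  have hU' : U \ Z ⊂ U := Finset.sdiff_ssubset hZU (Finset.nonempty_iff_ne_empty.2 hZ)
  have e1 : expect p (edgeObs ends U s F₁ * (REvent ends U s X).indicator 1) =
      ∑ ω, weight p ω * expect p (edgeObs ends (U \ Z) s F₁ *
        (REvent ends (U \ Z) s ((X \ Z) ∪ frontier ends U Z ω)).indicator 1) := by
    rw [← expect_edgeObs_mul_indicator_eq_sum p ends hZU hsZ F₁ (X \ Z),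
      Finset.sdiff_union_of_subset hZX]
  have e2 : expect p (edgeObs ends U s F₂ * (REvent ends U s Y).indicator 1) =
      ∑ ω, weight p ω * expect p (edgeObs ends (U \ Z) s F₂ *
        (REvent ends (U \ Z) s ((Y \ Z) ∪ frontier ends U Z ω)).indicator 1) := by
    rw [← expect_edgeObs_mul_indicator_eq_sum p ends hZU hsZ F₂ (Y \ Z),
      Finset.sdiff_union_of_subset hZY]
  have e3 : expect p (edgeObs ends U s (F₁ * F₂) * (REvent ends U s Z).indicator 1) =
      ∑ ω, weight p ω * expect p (edgeObs ends (U \ Z) s (F₁ * F₂) *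
        (REvent ends (U \ Z) s (∅ ∪ frontier ends U Z ω)).indicator 1) := by
    rw [← expect_edgeObs_mul_indicator_eq_sum p ends hZU hsZ (F₁ * F₂) ∅, Finset.empty_union]
  have e4 : prob p (REvent ends U s (X ∪ Y)) =
      ∑ ω, weight p ω * expect p (edgeObs ends (U \ Z) s (fun _ => 1) *
        (REvent ends (U \ Z) s (((X \ Z) ∪ (Y \ Z)) ∪ frontier ends U Z ω)).indicator 1) := by
    rw [← expect_edgeObs_mul_indicator_eq_sum p ends hZU hsZ (fun _ => 1) ((X \ Z) ∪ (Y \ Z)),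
      edgeObs_one, one_mul, ← prob_eq_expect_indicator, ← Finset.union_sdiff_distrib,
      Finset.sdiff_union_of_subset (hZX.trans Finset.subset_union_left)]
  rw [e1, e2, e3, e4]
  refine four_functions_theorem_univ
    (fun ω => weight p ω * expect p (edgeObs ends (U \ Z) s F₁ *
      (REvent ends (U \ Z) s ((X \ Z) ∪ frontier ends U Z ω)).indicator 1))
    (fun ω => weight p ω * expect p (edgeObs ends (U \ Z) s F₂ *
      (REvent ends (U \ Z) s ((Y \ Z) ∪ frontier ends U Z ω)).indicator 1))
    (fun ω => weight p ω * expect p (edgeObs ends (U \ Z) s (F₁ * F₂) *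
      (REvent ends (U \ Z) s (∅ ∪ frontier ends U Z ω)).indicator 1))
    (fun ω => weight p ω * expect p (edgeObs ends (U \ Z) s (fun _ => 1) *
      (REvent ends (U \ Z) s (((X \ Z) ∪ (Y \ Z)) ∪ frontier ends U Z ω)).indicator 1))
    (fun ω => mul_nonneg (weight_nonneg hp ω)
      (expect_nonneg hp (edgeObs_mul_indicator_nonneg ends _ s hF₁0 _)))
    (fun ω => mul_nonneg (weight_nonneg hp ω)
      (expect_nonneg hp (edgeObs_mul_indicator_nonneg ends _ s hF₂0 _)))
    (fun ω => mul_nonneg (weight_nonneg hp ω)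
      (expect_nonneg hp (edgeObs_mul_indicator_nonneg ends _ s hF0 _)))
    (fun ω => mul_nonneg (weight_nonneg hp ω)
      (expect_nonneg hp (edgeObs_mul_indicator_nonneg ends _ s (fun _ => zero_le_one) _))) ?_
  intro ω ω'
  have hX'' : (X \ Z) ∪ frontier ends U Z ω ⊆ U \ Z :=
    Finset.union_subset (Finset.sdiff_subset_sdiff hX (le_refl Z)) (frontier_subset ω)
  have hY'' : (Y \ Z) ∪ frontier ends U Z ω' ⊆ U \ Z :=
    Finset.union_subset (Finset.sdiff_subset_sdiff hY (le_refl Z)) (frontier_subset ω')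
  have hIH := ih (U \ Z) hU' ((X \ Z) ∪ frontier ends U Z ω) ((Y \ Z) ∪ frontier ends U Z ω')
    hX'' hY''
  have h3 : expect p (edgeObs ends (U \ Z) s (F₁ * F₂) * (REvent ends (U \ Z) s
      (((X \ Z) ∪ frontier ends U Z ω) ∩ ((Y \ Z) ∪ frontier ends U Z ω'))).indicator 1) ≤
      expect p (edgeObs ends (U \ Z) s (F₁ * F₂) *
        (REvent ends (U \ Z) s (∅ ∪ frontier ends U Z (ω ⊓ ω'))).indicator 1) := by
    refine expect_edgeObs_mul_indicator_mono hp ends _ s hF0 (REvent_anti _ _ _ ?_)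
    rw [Finset.empty_union]
    exact (frontier_inf_subset ω ω').trans
      (Finset.inter_subset_inter Finset.subset_union_right Finset.subset_union_right)
  have h4 : prob p (REvent ends (U \ Z) s
      (((X \ Z) ∪ frontier ends U Z ω) ∪ ((Y \ Z) ∪ frontier ends U Z ω'))) =
      expect p (edgeObs ends (U \ Z) s (fun _ => 1) *
        (REvent ends (U \ Z) s (((X \ Z) ∪ (Y \ Z)) ∪ frontier ends U Z (ω ⊔ ω'))).indicator 1) := by
    rw [edgeObs_one, one_mul, ← prob_eq_expect_indicator, frontier_sup]
    congr 2
    ext x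
    simp only [Finset.mem_union]
    tauto
  have n3 : 0 ≤ expect p (edgeObs ends (U \ Z) s (F₁ * F₂) *
      (REvent ends (U \ Z) s (∅ ∪ frontier ends U Z (ω ⊓ ω'))).indicator 1) :=
    expect_nonneg hp (edgeObs_mul_indicator_nonneg ends _ s hF0 _)
  have n4 : 0 ≤ prob p (REvent ends (U \ Z) s
      (((X \ Z) ∪ frontier ends U Z ω) ∪ ((Y \ Z) ∪ frontier ends U Z ω'))) := prob_nonneg hp _
  calc weight p ω * expect p (edgeObs ends (U \ Z) s F₁ *
          (REvent ends (U \ Z) s ((X \ Z) ∪ frontier ends U Z ω)).indicator 1) *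
        (weight p ω' * expect p (edgeObs ends (U \ Z) s F₂ *
          (REvent ends (U \ Z) s ((Y \ Z) ∪ frontier ends U Z ω')).indicator 1))
      = (weight p ω * weight p ω') *
          (expect p (edgeObs ends (U \ Z) s F₁ *
            (REvent ends (U \ Z) s ((X \ Z) ∪ frontier ends U Z ω)).indicator 1) *
          expect p (edgeObs ends (U \ Z) s F₂ *
            (REvent ends (U \ Z) s ((Y \ Z) ∪ frontier ends U Z ω')).indicator 1)) := by ring
    _ ≤ (weight p ω * weight p ω') *
          (expect p (edgeObs ends (U \ Z) s (F₁ * F₂) *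
            (REvent ends (U \ Z) s (∅ ∪ frontier ends U Z (ω ⊓ ω'))).indicator 1) *
          expect p (edgeObs ends (U \ Z) s (fun _ => 1) *
            (REvent ends (U \ Z) s (((X \ Z) ∪ (Y \ Z)) ∪
              frontier ends U Z (ω ⊔ ω'))).indicator 1)) :=
        mul_le_mul_of_nonneg_left (hIH.trans (mul_le_mul h3 (le_of_eq h4) n4 n3))
          (mul_nonneg (weight_nonneg hp ω) (weight_nonneg hp ω'))
    _ = weight p (ω ⊓ ω') * expect p (edgeObs ends (U \ Z) s (F₁ * F₂) *
          (REvent ends (U \ Z) s (∅ ∪ frontier ends U Z (ω ⊓ ω'))).indicator 1) *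
        (weight p (ω ⊔ ω') * expect p (edgeObs ends (U \ Z) s (fun _ => 1) *
          (REvent ends (U \ Z) s (((X \ Z) ∪ (Y \ Z)) ∪
            frontier ends U Z (ω ⊔ ω'))).indicator 1)) := by
        rw [← weight_inf_mul_weight_sup p ω ω']
        ring

end EdgeBHKMain

/-! ## The whole graph -/

section Whole

variable {V : Type*} {E : Type*} [Fintype E] [DecidableEq E] [Fintype V] [DecidableEq V]
  {R : Type*} [CommRing R] [LinearOrder R] [IsStrictOrderedRing R]

/-- The open-edge cluster of `s` in the whole graph. -/
def edgeCluster (ends : E → Sym2 V) (s : V) (ω : Config E) : Set E :=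
  {e | ω e = true ∧ ∃ x y, ends e = s(x, y) ∧ x ∈ cluster ends ω s}

omit [Fintype E] [DecidableEq E] [DecidableEq V] in
/-- The edge cluster in `G[V]` is the edge cluster of the whole graph. -/
lemma edgeClusterIn_univ (ends : E → Sym2 V) (s : V) (ω : Config E) :
    edgeClusterIn ends Finset.univ s ω = edgeCluster ends s ω := by
  ext e
  simp only [mem_edgeClusterIn, edgeCluster, Set.mem_setOf_eq, Finset.coe_univ, induced_univ,
    clusterIn]

/-- **van den Berg–Häggström–Kahn, edge-cluster form** (BHK06 Thm 1.1/1.3), whole graph: for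
nonnegative monotone functionals `F₁, F₂` of the open-edge cluster of `s` and vertex sets `X, Y`,
with `R_X = {s ↮ x ∀ x ∈ X}`,
`E(F₁(EC_s) 1_{R_X}) · E(F₂(EC_s) 1_{R_Y}) ≤ E((F₁F₂)(EC_s) 1_{R_{X∩Y}}) · P(R_{X∪Y})`. -/
theorem bhk_edge (p : E → R) (hp : IsProbVec p) (ends : E → Sym2 V) (s : V) {F₁ F₂ : Set E → R}
    (hF₁ : Monotone F₁) (hF₂ : Monotone F₂) (hF₁0 : ∀ S, 0 ≤ F₁ S) (hF₂0 : ∀ S, 0 ≤ F₂ S)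
    (X Y : Finset V) :
    expect p (fun ω => F₁ (edgeCluster ends s ω) * (avoidAll ends s X).indicator 1 ω) *
        expect p (fun ω => F₂ (edgeCluster ends s ω) * (avoidAll ends s Y).indicator 1 ω) ≤
      expect p (fun ω => (F₁ * F₂) (edgeCluster ends s ω) * (avoidAll ends s (X ∩ Y)).indicator 1 ω) *
        prob p (avoidAll ends s (X ∪ Y)) := by
  have h := bhk_edge_induced p hp ends s hF₁ hF₂ hF₁0 hF₂0 Finset.univ X Y
    (Finset.subset_univ X) (Finset.subset_univ Y)
  simp only [REvent_univ] at h
  have e : ∀ (F : Set E → R) (A : Set (Config E)),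
      (edgeObs ends Finset.univ s F * A.indicator (1 : Config E → R)) =
        fun ω => F (edgeCluster ends s ω) * A.indicator 1 ω := by
    intro F A
    funext ω
    simp only [Pi.mul_apply, edgeObs_apply, edgeClusterIn_univ]
  simpa only [e] using h

end Whole

end Summit.Ventures.PercRepro2
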